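import Mathlib
import Summits.NavierStokesRegularity.NavierStokesRegularity.Theorems.SubOnsagerCeilingOrthantTailCeiling.Negative.OrthantTailCeilingFalseOfSideBranchCeilingEscape
import HarnessLib

/-!
# Route SubOnsagerCeiling — PER-SHELL RETENTION implies the ceiling-assisted escape of `α_SB`
# (helper file for item stmt-NavierStokesRegularity-25507 `OrthantTailCeiling`; `--supports`)

The negative lemmas `OrthantTailCeiling_false_of_SideBranchCeilingEscape` /
`ForwardTailCeiling_false_of_SideBranchCeilingEscape` (p824789 / p824871) leave ONE construction debt,
`SideBranchCeilingEscapeAt ε₀`: for each candidate ceiling `(θ, C)` one block `0..K` of the side-branch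
table must lose more than `C E₀ b^{-2θ(K+1)}` by a viscosity-uniform time.  This file reduces that debt
to its natural PER-SHELL form and records the bookkeeping once and for all:

* the PER-SHELL RETENTION hypothesis (stated inline here; named `SideBranchShellRetentionAt ε₀ g η₀` in the
  sibling file `…SideBranchShellRetentionTarget.lean`): at a `ν`-uniform time `T = T(K)`,
  along every non-negative (ceiling-obeying) regular solution from a fixed one-shell datum, the datum
  shell retains at most `η₀E₀`, and every shell `1 ≤ j ≤ K` holds at most the fraction `g` of the energy
  `E₀ − B_{j-1}(T)` that has escaped past the bond `j−1` (`B_{j-1}` = energy of the block `0..j−1`).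
  The shell `j` consists of the dead-end pocket `z_j` (fed through the side mode `s_{j-1}`) plus the
  transiting chain/side modes `x_j, s_j`; so the hypothesis is the SPLIT ESTIMATE (the pocket takes at
  most a fraction of what passes) together with the RELAXATION of the transiting modes;
* `sideBranch_loss_geometric` — the bookkeeping: these per-shell bounds give
  `E₀ − B_K(T) ≥ (1−η₀)(1−g)^K E₀` (induction on the shell);
* `sideBranchCeilingEscapeAt_of_shellRetention` — **if `g ≤ 1 − 1/(1+ε₀)` (i.e. `(1−g)·b ≥ 1`, the
  ONSAGER-CRITICAL retention) and `η₀ < 1`, then per-shell retention `→ SideBranchCeilingEscapeAt ε₀`**: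
  `(1−η₀)(1−g)^K ≥ (1−η₀)b^{-K}` beats `C b^{-2θ(K+1)}` at every large depth because `2θ > 1`.

NUMERICS (this seat, independent explicit RK4 instrument with exact viscous splitting and a lid, MODEL
only): the measured per-shell fractions `e_j(T)/(E₀ − B_{j-1}(T))` along the `x₀`-datum solution of
`α_SB` are `≤ 0.21` at `b = 2` (allowed: `0.5`) and `≤ 0.18` at `b = 3/2` (allowed: `1/3`), decreasing to
`≈ 0.02` within ten shells; the chain keeps `≈ 34 %` (`b = 2`) / `≈ 22 %` (`b = 3/2`) of `E₀` running past
every shell.  So the hypothesis is expected to hold with room; it is NOT proved here (the analytic core is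
the competition between the chain receiver `x_{k+1}`, drained by the deeper conveyor, and the side mode
`s_k`, drained by its own pocket; bricks: `…SideBranchChoke`, `…SideBranchSideRelax`, `…ChainDrive`,
`…ThresholdStep`).

HONEST FRAMING: MODEL lattice ODEs only (Tao 2016 §4 vocabulary; rung TL-M2Break); a reduction between
two unproved statements plus elementary bookkeeping; settles nothing by itself; nothing here is a
statement about the Navier–Stokes equations. [cite: Tao2016AveragedNS, §4 (4.5), the viscous equation
before Thm. 4.2]; Katz–Pavlović couplings: [cite: BarbatoMorandinRomito2011, §2].
-/

noncomputable section

-- the sub-problem namespace `NavierStokesRegularity.NavierStokesRegularity` is the tree's layout (D-0017)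
set_option linter.dupNamespace false

namespace Summit.NavierStokesRegularity.NavierStokesRegularity.Theorems.SubOnsagerCeiling

open Set Filter
open scoped Topology
open Literature.Analysis.FluidPDE.TaoCascade
open Summit.NavierStokesRegularity.NavierStokesRegularity.Theses.SubOnsagerCeiling

/-! ## §1 Bookkeeping: per-shell retention gives a geometric remainder -/

/-- **Geometric remainder.** For a sequence of shell energies `e : ℕ → ℝ` with `e 0 ≤ η₀ E₀` and
`e j ≤ g·(E₀ − Σ_{m<j} e m)` for `1 ≤ j ≤ K`, where `g ≤ 1`: `E₀ − Σ_{m ≤ K} e m ≥ (1−η₀)(1−g)^K E₀`.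
[folklore] -/
theorem sideBranch_loss_geometric {e : ℕ → ℝ} {E₀ g η₀ : ℝ} (hg1 : g ≤ 1)
    (h0 : e 0 ≤ η₀ * E₀) {K : ℕ}
    (hj : ∀ j : ℕ, 1 ≤ j → j ≤ K → e j ≤ g * (E₀ - ∑ m ∈ Finset.range j, e m)) :
    (1 - η₀) * (1 - g) ^ K * E₀ ≤ E₀ - ∑ m ∈ Finset.range (K + 1), e m := by
  induction K with
  | zero => simp; linarith
  | succ K ih =>
    have ih' := ih fun j hj1 hjK => hj j hj1 (hjK.trans (Nat.le_succ K))
    have hstep := hj (K + 1) (by omega) le_rfl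
    rw [Finset.sum_range_succ _ (K + 1)]
    have h1g : 0 ≤ 1 - g := by linarith
    calc (1 - η₀) * (1 - g) ^ (K + 1) * E₀
        = (1 - g) * ((1 - η₀) * (1 - g) ^ K * E₀) := by ring
      _ ≤ (1 - g) * (E₀ - ∑ m ∈ Finset.range (K + 1), e m) := mul_le_mul_of_nonneg_left ih' h1g
      _ = (E₀ - ∑ m ∈ Finset.range (K + 1), e m) - g * (E₀ - ∑ m ∈ Finset.range (K + 1), e m) := by
          ring
      _ ≤ (E₀ - ∑ m ∈ Finset.range (K + 1), e m) - e (K + 1) := by linarith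
      _ = E₀ - (∑ m ∈ Finset.range (K + 1), e m + e (K + 1)) := by ring

/-- Depth selection: if `0 ≤ r < 1`, `0 < a`, then `c · r^K < a` for some `K`. [folklore] -/
theorem sideBranch_exists_pow_lt {r c a : ℝ} (hr0 : 0 ≤ r) (hr1 : r < 1) (ha : 0 < a) :
    ∃ K : ℕ, c * r ^ K < a := by
  have htend : Tendsto (fun K : ℕ => c * r ^ K) atTop (𝓝 (c * 0)) :=
    (tendsto_pow_atTop_nhds_zero_of_lt_one hr0 hr1).const_mul c
  rw [mul_zero] at htend
  exact (htend.eventually (gt_mem_nhds ha)).exists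

/-! ## §2 Per-shell retention at the Onsager-critical rate gives the escape -/

/-- **PER-SHELL RETENTION `→ SideBranchCeilingEscapeAt ε₀`** (hypothesis inline: for every candidate
ceiling `(θ, C)` a one-shell datum of positive energy such that for every depth `K`, at a `ν`-uniform time
`T`, every non-negative ceiling-obeying regular solution on `[0,T]` has datum-shell energy `≤ η₀E₀` and
shell energies `e_j(T) ≤ g·(E₀ − B_{j-1}(T))`, `1 ≤ j ≤ K`) when the retained fraction is
at most Onsager-critical, `g ≤ 1 − 1/(1+ε₀)` (`(1−g)(1+ε₀) ≥ 1`), and the datum shell relaxes,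
`η₀ < 1`.  Given `(θ, C)`: the geometric remainder `(1−η₀)(1−g)^K E₀ ≥ (1−η₀) b^{-K} E₀` exceeds the
ceiling's tail `C E₀ b^{-2θ(K+1)}` as soon as `C b^{-2θ}·(b^{1-2θ})^K < 1 − η₀`, which happens at every
large depth since `2θ > 1`; at that depth the block `0..K` has lost `≥ (1−η₀)(1−g)^K E₀ =: w` at time `T`.
MODEL lattice only; a reduction between unproved statements. [this file] -/
theorem sideBranchCeilingEscapeAt_of_shellRetention {ε₀ g η₀ : ℝ} (hε : 0 < ε₀)
    (hg : g ≤ 1 - 1 / (1 + ε₀)) (hη : η₀ < 1)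
    (h : ∀ θ : ℝ, 1 / 2 < θ → ∀ C : ℝ, 0 ≤ C →
      ∃ X₀ : Fin 4 → ℝ, 0 < (∑ i : Fin 4, (1 / 2 : ℝ) * X₀ i ^ 2) ∧
      ∀ K : ℕ, ∃ T : ℝ, 0 < T ∧ ∃ ν₀ : ℝ, 0 < ν₀ ∧
      ∀ ν : ℝ, 0 < ν → ν ≤ ν₀ →
      ∀ X : Fin 4 → ℤ → ℝ → ℝ,
      (∀ (i : Fin 4) (k : ℤ), X i k 0 = if k = 0 then X₀ i else 0) →
      (∀ (i : Fin 4) (k : ℤ), k < 0 → ∀ t : ℝ, X i k t = 0) →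
      (∃ M : ℝ, ∀ (t : ℝ) (i : Fin 4) (k : ℤ), (1 + (1 + ε₀) ^ ((10 : ℝ) * k)) * |X i k t| ≤ M) →
      (∀ (i : Fin 4) (k : ℤ), Continuous (X i k)) →
      (∀ (i : Fin 4) (k : ℤ), ∀ t ∈ Set.Icc (0 : ℝ) T, HasDerivWithinAt (X i k)
      (quadTerm ε₀ sideBranchTable X i k t - ν * (1 + ε₀) ^ ((2 : ℝ) * k) * X i k t)
      (Set.Icc (0 : ℝ) T) t) →
      (∀ t ∈ Set.Icc (0 : ℝ) T, ∀ (i : Fin 4) (k : ℤ), 1 ≤ k → 0 ≤ X i k t) →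
      (∀ n N : ℕ, n ≤ N → ∀ u ∈ Set.Icc (0 : ℝ) T,
      ∑ k ∈ Finset.Icc n N, ∑ i : Fin 4, (1 / 2 : ℝ) * X i (k : ℤ) u ^ 2 ≤
      C * (∑ i : Fin 4, (1 / 2 : ℝ) * X₀ i ^ 2) * (1 + ε₀) ^ (-(2 * θ * (n : ℝ)))) →
      (∑ i : Fin 4, (1 / 2 : ℝ) * X i 0 T ^ 2) ≤ η₀ * (∑ i : Fin 4, (1 / 2 : ℝ) * X₀ i ^ 2) ∧
      (∀ j : ℕ, 1 ≤ j → j ≤ K →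
      (∑ i : Fin 4, (1 / 2 : ℝ) * X i (j : ℤ) T ^ 2) ≤
      g * ((∑ i : Fin 4, (1 / 2 : ℝ) * X₀ i ^ 2) -
      ∑ m ∈ Finset.range j, ∑ i : Fin 4, (1 / 2 : ℝ) * X i (m : ℤ) T ^ 2))) :
    SideBranchCeilingEscapeAt ε₀ := by
  intro θ hθ C hC
  have hb : (0 : ℝ) < 1 + ε₀ := by linarith
  have hb1 : (1 : ℝ) < 1 + ε₀ := by linarith
  obtain ⟨X₀, hE₀, hK⟩ := h θ hθ C hC
  set E₀ : ℝ := ∑ i : Fin 4, (1 / 2 : ℝ) * X₀ i ^ 2 with hE₀def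
  -- `1 − g ≥ 1/b`
  have hg1 : g ≤ 1 := hg.trans (by
    have : 0 < 1 / (1 + ε₀) := by positivity
    linarith)
  have hbinv : (1 + ε₀)⁻¹ ≤ 1 - g := by rw [← one_div]; linarith
  -- depth: `C b^{-2θ} r^K < 1 − η₀`, `r = b^{1-2θ} < 1`
  set r : ℝ := (1 + ε₀) ^ (1 - 2 * θ) with hrdef
  have hr0 : 0 ≤ r := Real.rpow_nonneg hb.le _
  have hr1 : r < 1 := Real.rpow_lt_one_of_one_lt_of_neg hb1 (by linarith)
  have h1η : 0 < 1 - η₀ := by linarith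
  obtain ⟨K, hKlt⟩ := sideBranch_exists_pow_lt (c := C * (1 + ε₀) ^ (-(2 * θ))) hr0 hr1 h1η
  obtain ⟨T, hT, ν₀, hν₀, hν⟩ := hK K
  -- the escape amount
  set w : ℝ := (1 - η₀) * (1 - g) ^ K * E₀ with hwdef
  refine ⟨K, X₀, hE₀, T, hT, ν₀, hν₀, w, ?_, fun ν hνpos hνle => ⟨T, hT, le_rfl, ?_⟩⟩
  · -- `C E₀ b^{-2θ(K+1)} < w`
    -- (i) `C b^{-2θ(K+1)} = C b^{-2θ} r^K b^{-K}`
    have hsplit : (1 + ε₀) ^ (-(2 * θ * ((K + 1 : ℕ) : ℝ))) =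
        (1 + ε₀) ^ (-(2 * θ)) * (r ^ K * ((1 + ε₀)⁻¹) ^ K) := by
      rw [hrdef, ← Real.rpow_mul_natCast hb.le, ← Real.rpow_neg_one, ← Real.rpow_mul_natCast hb.le,
        ← Real.rpow_add hb, ← Real.rpow_add hb]
      congr 1
      push_cast
      ring
    -- (ii) `b^{-K} ≤ (1-g)^K`
    have hpow : ((1 + ε₀)⁻¹) ^ K ≤ (1 - g) ^ K :=
      pow_le_pow_left₀ (inv_nonneg.2 hb.le) hbinv K
    have hbK : 0 ≤ ((1 + ε₀)⁻¹) ^ K := pow_nonneg (inv_nonneg.2 hb.le) K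
    have h2θ : 0 ≤ C * (1 + ε₀) ^ (-(2 * θ)) := mul_nonneg hC (Real.rpow_nonneg hb.le _)
    calc C * E₀ * (1 + ε₀) ^ (-(2 * θ * ((K + 1 : ℕ) : ℝ)))
        = (C * (1 + ε₀) ^ (-(2 * θ)) * r ^ K) * ((1 + ε₀)⁻¹) ^ K * E₀ := by rw [hsplit]; ring
      _ < (1 - η₀) * ((1 + ε₀)⁻¹) ^ K * E₀ + ((1 - η₀) * ((1 - g) ^ K - ((1 + ε₀)⁻¹) ^ K) * E₀) := by
          have h1 : (C * (1 + ε₀) ^ (-(2 * θ)) * r ^ K) * ((1 + ε₀)⁻¹) ^ K * E₀ ≤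
              (1 - η₀) * ((1 + ε₀)⁻¹) ^ K * E₀ :=
            mul_le_mul_of_nonneg_right (mul_le_mul_of_nonneg_right hKlt.le hbK) hE₀.le
          have h2 : 0 ≤ (1 - η₀) * ((1 - g) ^ K - ((1 + ε₀)⁻¹) ^ K) * E₀ :=
            mul_nonneg (mul_nonneg h1η.le (by linarith)) hE₀.le
          -- strictness: from `hKlt` strict and `b^{-K} E₀ > 0`
          have hbKpos : 0 < ((1 + ε₀)⁻¹) ^ K * E₀ := mul_pos (pow_pos (inv_pos.2 hb) K) hE₀
          nlinarith
      _ = w := by rw [hwdef]; ring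
  · intro X hinit hlow hbd hcont hder hpos hceil
    obtain ⟨h0, hj⟩ := hν ν hνpos hνle X hinit hlow hbd hcont hder hpos hceil
    -- bookkeeping on the shell energies at time `T`
    have hgeo := sideBranch_loss_geometric (e := fun m : ℕ => ∑ i : Fin 4, (1 / 2 : ℝ) * X i (m : ℤ) T ^ 2)
      (E₀ := E₀) hg1 (by simpa using h0) (K := K) (fun j hj1 hjK => by simpa using hj j hj1 hjK)
    rw [hwdef]
    linarith

end Summit.NavierStokesRegularity.NavierStokesRegularity.Theorems.SubOnsagerCeiling

end
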